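import Summits.ABC.IUTFork.Joshi.ThetaValuesLocus
import Summits.ABC.IUTFork.Joshi.ThetaJoshiConstruction
import HarnessLib

/-!
# [J-III] §6.4 lift carrier `ATS3.ThetaLiftDatum` REALISED over E-t3's period-ring signature `PeriodRingDatum` ([J-IIp] §2, §7.4):
# merge-debt reconciliation, and the DISCHARGE of `TeichLiftExists` ([J-IIp] Thm. 8.1.1 as invoked in [J-III] §6.4.2)

Proof/bridge file of the abc-iut cell, block E «type Joshi's construction, test vs S» (rung LADDER-ABC:A2.E; seat abc-iut-E-t10 — the
owner of the interim carrier being reconciled; batch-3 merge-debt row of plan/E/ASSIGNMENTS.md §3 / E-PLAN R4a, R12). TAKES NO SIDE on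
[IUTchIII] Cor. 3.12, on Joshi's claims or on Mochizuki's report; typed ≠ proved ≠ endorsed; object-side (E-PLAN R14: imports Joshi
object files only). Sources: [J-III] = arXiv:2401.13508v4 §6.4.2–§6.4.3 (pp.46–48) and [J-IIp] = arXiv:2303.01662v3 §2, §7.4 (the
signature E-t3 typed as `Summit.ABC.IUTFork.Joshi.PeriodRingDatum`, p427971 `Joshi/ThetaValuesLocus.lean`).

WHAT IS DONE. `ThetaJoshiConstruction.lean` (p428539) wrote §6.4 over an INTERIM carrier `ATS3.ThetaLiftDatum OE B Y` whose module
docstring records the merge-debt «duplicates E-t3's `PeriodRingDatum` ([J-IIp] §2, §7: `B`, `[·]`, `|·|_ρ`, `η_{K_y}`, `T_y`)». Here that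
debt is PAID: `PeriodRingDatum.toThetaLiftDatum` builds the §6.4 lift datum from E-t3's signature —
* `𝔪_y := ker η_{K_y}` (E-t3's `eta y : B →+* K_y`), MAXIMAL because `η_{K_y}` is onto the field `K_y` (`hη`, the printed «B_E → B_E/𝔪_{y′} =
  K_{y′}», [J-III] p.47 l.78–81 / Prop. 6.6.1 p.48 l.37–41 — an inline hypothesis on the carrier: E-t3's signature records lifts of the
  INTEGRAL elements only, `exists_teich_lift`), and the residue field `B ⧸ 𝔪_y` identified with `K_y` by Mathlib's
  `RingHom.quotientKerEquivOfSurjective`;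
* `[·]`, `|·|_{ℂ_p^♭}`, `|·|_ρ` and `|[z]|_ρ = |z|` = E-t3's `teich`, `absF`, `norm`, `norm_teich`; `|·|_{K_y}` transported to `B ⧸ 𝔪_y`, with
  `|ψ_y([z])|_{K_y} = |z|` = E-t3's `absK_eta_teich` ([FF18 Prop. 2.2.17]);
* the theta value `ξ_{1;K_y}`, the Tate parameter `q_{X/E,y}` (elements of `K_y`, parameters — E-t3's signature does not single them out) and
  the Tate-module generator `t_y ∈ T_y` (parameter with `ht : t y ∈ D.T y`), `t_y ∈ 𝔪_y` from E-t3's `eta_T` ([J-IIp] Prop. 7.4.2 (3)).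
CONSEQUENCES (kernel): `isTeichLift_iff` — being a Teichmüller lift in the sense of p428539 is `η_{K_y}([z]) = ξ_{1;K_y}` in E-t3's
vocabulary; **`teichLiftExists_of_abs_le_one`** — p428539's HYPOTHESIS `TeichLiftExists` ([J-IIp] Thm. 8.1.1 as invoked in [J-III] §6.4.2,
p.46 l.48–53) is a THEOREM over E-t3's signature as soon as the theta values are integral (`|ξ_{1;K_y}|_{K_y} ≤ 1`, [J-IIp] §5.1 «ξ_j ∈
O_Ē»), by `exists_teich_lift` ([FF18 Cor. 2.2.8]) — one named hypothesis of the §6.4 typing DISCHARGED; hence admissible lifts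
(Def. 6.4.3.1) EXIST over every Ansatz tuple in E-t3's setting (`admissibleLifts_nonempty_of_abs_le_one`), and every element of Joshi's
lift set `[z] + O_E·t_y` reduces to `ξ` under `η_{K_y}` (`eta_of_mem_liftSet`). Scalars `O_E` stay a parameter (`[Algebra OE B]`; at
`E = ℚ_p`, `O_E = ℤ_p`). No FACT-LIST row consumed; no new `Prop` introduced; nothing of Joshi's asserted.
-/

noncomputable section

namespace Summit.ABC.IUTFork.Joshi

namespace PeriodRingDatum

variable {F B E0 : Type} [Field F] [CommRing B] [Field E0] {Y : Type} {K : Y → Type} [∀ y, Field (K y)] {G : Type}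
  (D : PeriodRingDatum F B E0 Y K G)

/-- **The §6.4 lift carrier over E-t3's period-ring signature** (merge-debt reconciliation): `𝔪_y = ker η_{K_y}`, residue field
`B ⧸ 𝔪_y ≅ K_y`, Teichmüller map / norms / residue absolute values from `D`, theta value `ξ_{1;K_y}` and Tate parameter `q_{X/E,y}` read in
`K_y` (parameters `ξ`, `q`), Tate-module generator `t_y ∈ T_y` (parameter `t`, `ht`). Hypothesis `hη`: `η_{K_y} : B → K_y` is onto
([J-III] p.47 l.78–81 «B_E → B_E/𝔪_{y′_j} = K_{y′_j}»). [claim: Joshi2024ATS3, status: disputed] -/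
def toThetaLiftDatum (hη : ∀ y, Function.Surjective (D.eta y)) (ξ q : ∀ y, K y) (t : Y → B) (ht : ∀ y, t y ∈ D.T y)
    (OE : Type) [CommRing OE] [Algebra OE B] : ATS3.ThetaLiftDatum OE B Y where
  m y := RingHom.ker (D.eta y)
  m_isMaximal y := RingHom.ker_isMaximal_of_surjective (D.eta y) (hη y)
  Cflat := F
  teich := D.teich
  absFlat := D.absF
  norm := D.norm
  norm_teich ρ h0 h1 z := D.norm_teich ρ z h0 h1
  absK y x := D.absK y (RingHom.quotientKerEquivOfSurjective (hη y) x)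
  absK_teich y z := by
    simp only [RingHom.quotientKerEquivOfSurjective_apply_mk]
    exact D.absK_eta_teich y z
  xi y := (RingHom.quotientKerEquivOfSurjective (hη y)).symm (ξ y)
  tate y := (RingHom.quotientKerEquivOfSurjective (hη y)).symm (q y)
  tgen := t
  tgen_mem y := (RingHom.mem_ker).2 (D.eta_T y (t y) (ht y))

variable (hη : ∀ y, Function.Surjective (D.eta y)) (ξ q : ∀ y, K y) (t : Y → B) (ht : ∀ y, t y ∈ D.T y)
  (OE : Type) [CommRing OE] [Algebra OE B]

/-- In E-t3's vocabulary, «`[z]` is a Teichmüller lift of `ξ_{1;K_y}`» (p428539 `IsTeichLift`: `ψ_y([z]) = ξ` in `B ⧸ 𝔪_y`) is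
`η_{K_y}([z]) = ξ_{1;K_y}` in `K_y`. PROVED. [folklore] -/
theorem isTeichLift_iff (y : Y) (z : F) :
    (D.toThetaLiftDatum hη ξ q t ht OE).IsTeichLift y z ↔ D.eta y (D.teich z) = ξ y := by
  unfold ATS3.ThetaLiftDatum.IsTeichLift
  change Ideal.Quotient.mk (RingHom.ker (D.eta y)) (D.teich z) =
    (RingHom.quotientKerEquivOfSurjective (hη y)).symm (ξ y) ↔ _
  rw [RingEquiv.eq_symm_apply, RingHom.quotientKerEquivOfSurjective_apply_mk]

/-- **`TeichLiftExists` DISCHARGED over E-t3's signature**: if the theta values are integral (`|ξ_{1;K_y}|_{K_y} ≤ 1` — [J-IIp] §5.1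
p.13 l.27–40 «ξ_j ∈ O_Ē», `|ξ_1| = |q^{1/2ℓ}| < 1`), then every `ξ_{1;K_y}` has a Teichmüller lift with `|[z]|_ρ = |z| = |ξ|_{K_y}` —
p428539's claim-def `TeichLiftExists` ([J-IIp] Thm. 8.1.1 as invoked in [J-III] §6.4.2 p.46 l.48–53) HOLDS, by E-t3's field
`exists_teich_lift` ([FF18 Cor. 2.2.8]) and p428539's `teichLiftExists_iff`. [claim: Joshi2024ATS3, status: disputed] -/
theorem teichLiftExists_of_abs_le_one (hξ : ∀ y, D.absK y (ξ y) ≤ 1) :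
    (D.toThetaLiftDatum hη ξ q t ht OE).TeichLiftExists := by
  rw [ATS3.ThetaLiftDatum.teichLiftExists_iff]
  intro y
  obtain ⟨z, hz⟩ := D.exists_teich_lift y (ξ y) (hξ y)
  exact ⟨z, (D.isTeichLift_iff hη ξ q t ht OE y z).2 hz⟩

/-- Hence ADMISSIBLE LIFTS (Def. 6.4.3.1) exist over every tuple of an Ansatz `An` in E-t3's setting, for integral theta values.
PROVED (p428539 `admissibleLifts_nonempty_of_teichLiftExists`). [claim: Joshi2024ATS3, status: disputed] -/
theorem admissibleLifts_nonempty_of_abs_le_one (hξ : ∀ y, D.absK y (ξ y) ≤ 1) {n : ℕ} {An : Set (Fin n → Y)}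
    {y : Fin n → Y} (hy : y ∈ An) : ((D.toThetaLiftDatum hη ξ q t ht OE).admissibleLifts An y).Nonempty :=
  (D.toThetaLiftDatum hη ξ q t ht OE).admissibleLifts_nonempty_of_teichLiftExists
    (D.teichLiftExists_of_abs_le_one hη ξ q t ht OE hξ) hy

/-- Joshi's lift set (6.4.2.1) `[z] + O_E·t_y` over E-t3's signature reduces to `ξ_{1;K_y}` under `η_{K_y}` — the two carriers agree
on what a lift is (`T_y ⊆ ker η`, [J-IIp] Prop. 7.4.2 (3)). PROVED. [folklore] -/
theorem eta_of_mem_liftSet {y : Y} {z : F} (hz : D.eta y (D.teich z) = ξ y) {x : B}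
    (hx : x ∈ (D.toThetaLiftDatum hη ξ q t ht OE).liftSet y z) : D.eta y x = ξ y := by
  obtain ⟨l, rfl⟩ := hx
  change D.eta y (D.teich z + l • t y) = ξ y
  rw [map_add, hz, Algebra.smul_def, map_mul, D.eta_T y (t y) (ht y), mul_zero, add_zero]

/-- The norm of any Teichmüller lift of `ξ_{1;K_y}` is `|ξ_{1;K_y}|_{K_y}`, in E-t3's vocabulary (Rmk. 6.4.2.2 / [J-IIp] Prop. 7.4.2 (2) across
the bridge). PROVED. [folklore] -/
theorem norm_teich_of_eta_eq {y : Y} {z : F} (hz : D.eta y (D.teich z) = ξ y) {ρ : ℝ} (h0 : 0 < ρ) (h1 : ρ ≤ 1) :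
    D.norm ρ (D.teich z) = D.absK y (ξ y) := by
  rw [D.norm_teich ρ z h0 h1, ← hz, D.absK_eta_teich]

end PeriodRingDatum

end Summit.ABC.IUTFork.Joshi

end
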